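import Mathlib
import Literature.Analysis.OperatorTheory.ContractiveDeterminantalRepresentations
import HarnessLib

/-!
# Crux `PriceOfContractivity` (stmt-ValiantsHypothesis-10583), line `registered` — stub
# `stub_pencil_blockTriangular` (block upper-triangular Sylvester pencils factorize; norm of a
# direct sum)

Route `ValiantsHypothesis/ContractivityPrice`, crux K1
(`Summit.ValiantsHypothesis.ValiantsHypothesis.Theses.ContractivityPrice.PriceOfContractivity`).
Every realization of the line `registered` (skeleton rev 8) is a Sylvester pencil
`1 + Matrix.diagonal (fun i => X (κ i)) * K.map C` of size `R` with a colouring `κ : Fin R → σ`.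
This file proves the registered structural stub `stub_pencil_blockTriangular`, the piece that
reduces the norm-halving step to matrices `K` with strongly connected support:

1. for a block upper-triangular `K = [[A, Bm], [0, D]]` (reindexed to `Fin (R₁ + R₂)` by
   `finSumFinEquiv`) with the concatenated colouring `Sum.elim κ₁ κ₂ ∘ finSumFinEquiv.symm`, the
   pencil `1 + diag (X ∘ κ) · K` is block upper-triangular as well, so its determinant is the
   product of the pencil determinants of `A` (colouring `κ₁`) and of `D` (colouring `κ₂`);
2. the operator `(2,2)`-norm of the direct sum `A ⊕ D` (reindexed the same way) is at most
   `max ‖A‖ ‖D‖`.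

Proof. (1) `Literature.Analysis.OperatorTheory.det_pencil_reindex` removes the reindexing; the
Sum-indexed pencil of `fromBlocks A Bm 0 D` is, entrywise,
`fromBlocks (pencil A κ₁) (diag (X ∘ κ₁) · Bm) 0 (pencil D κ₂)` (`pencil_fromBlocks_zero₂₁`), and
`Matrix.det_fromBlocks_zero₂₁` computes the determinant of a block upper-triangular matrix.
(2) is `norm_toEuclideanCLM_reindex_le` followed by `norm_toEuclideanCLM_fromBlocks_le` (both in
the tree file `Literature/Analysis/OperatorTheory/ContractiveDeterminantalRepresentations.lean`).
-/

noncomputable section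

-- `Summit.<Summit>.<Problem>` repeats `ValiantsHypothesis` by the tree's layout convention (D-0017).
set_option linter.dupNamespace false

namespace Summit.ValiantsHypothesis.ValiantsHypothesis.Theorems.PriceOfContractivity.BlockTriangular

open Matrix MvPolynomial
open Literature.Analysis.OperatorTheory (det_pencil_reindex norm_toEuclideanCLM_reindex_le
  norm_toEuclideanCLM_fromBlocks_le)

/-- The Sylvester pencil of a block UPPER-TRIANGULAR matrix `[[A, B], [0, D]]` with the
concatenated colouring `Sum.elim κ₁ κ₂` is the block upper-triangular matrix whose diagonal
blocks are the pencils of `A` (colouring `κ₁`) and `D` (colouring `κ₂`) and whose off-diagonal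
block is `diag (X ∘ κ₁) · B`, i.e. `(i, j) ↦ X (κ₁ i) · C (B i j)` (written with `Matrix.of`: with
`import Mathlib` a rectangular `*` elaborates to the `CStarMatrix` instance, which `simp` does not
unfold). -/
theorem pencil_fromBlocks_zero₂₁ {σ m n : Type} [Fintype m] [Fintype n] [DecidableEq m]
    [DecidableEq n] (A : Matrix m m ℂ) (B : Matrix m n ℂ) (D : Matrix n n ℂ) (κ₁ : m → σ)
    (κ₂ : n → σ) :
    1 + Matrix.diagonal (fun i => MvPolynomial.X (Sum.elim κ₁ κ₂ i)) *
        (Matrix.fromBlocks A B 0 D).map (fun a : ℂ => (MvPolynomial.C a : MvPolynomial σ ℂ)) =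
      Matrix.fromBlocks
        (1 + Matrix.diagonal (fun i => MvPolynomial.X (κ₁ i)) *
          A.map (fun a : ℂ => (MvPolynomial.C a : MvPolynomial σ ℂ)))
        (Matrix.of fun i j => (MvPolynomial.X (κ₁ i) * MvPolynomial.C (B i j) : MvPolynomial σ ℂ))
        0
        (1 + Matrix.diagonal (fun i => MvPolynomial.X (κ₂ i)) *
          D.map (fun a : ℂ => (MvPolynomial.C a : MvPolynomial σ ℂ))) := by
  refine Matrix.ext fun i j => ?_
  rcases i with i | i <;> rcases j with j | j <;> simp [Matrix.diagonal_mul, Matrix.one_apply]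

/-- The pencil determinant of a block upper-triangular `[[A, B], [0, D]]` with the concatenated
colouring is the product of the pencil determinants of the diagonal blocks. -/
theorem det_pencil_fromBlocks_zero₂₁ {σ m n : Type} [Fintype m] [Fintype n] [DecidableEq m]
    [DecidableEq n] (A : Matrix m m ℂ) (B : Matrix m n ℂ) (D : Matrix n n ℂ) (κ₁ : m → σ)
    (κ₂ : n → σ) :
    (1 + Matrix.diagonal (fun i => MvPolynomial.X (Sum.elim κ₁ κ₂ i)) *
        (Matrix.fromBlocks A B 0 D).map (fun a : ℂ => (MvPolynomial.C a : MvPolynomial σ ℂ))).det =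
      (1 + Matrix.diagonal (fun i => MvPolynomial.X (κ₁ i)) *
          A.map (fun a : ℂ => (MvPolynomial.C a : MvPolynomial σ ℂ))).det *
        (1 + Matrix.diagonal (fun i => MvPolynomial.X (κ₂ i)) *
          D.map (fun a : ℂ => (MvPolynomial.C a : MvPolynomial σ ℂ))).det := by
  rw [pencil_fromBlocks_zero₂₁, Matrix.det_fromBlocks_zero₂₁]

/-- **Stub `stub_pencil_blockTriangular`** (line `registered`, skeleton rev 8). For a block
upper-triangular `K = [[A, Bm], [0, D]]` reindexed to `Fin (R₁ + R₂)` with the concatenated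
colouring, (1) the Sylvester pencil determinant factorizes as the product of the pencil
determinants of `A` and `D`, and (2) the operator norm of the (reindexed) direct sum `A ⊕ D` is
at most `max ‖A‖ ‖D‖`. -/
theorem stub_pencil_blockTriangular :
    ∀ {σ : Type} (R₁ R₂ : ℕ) (A : Matrix (Fin R₁) (Fin R₁) ℂ) (Bm : Matrix (Fin R₁) (Fin R₂) ℂ)
      (D : Matrix (Fin R₂) (Fin R₂) ℂ) (κ₁ : Fin R₁ → σ) (κ₂ : Fin R₂ → σ),
      (1 + Matrix.diagonal (fun i => MvPolynomial.X (Sum.elim κ₁ κ₂ (finSumFinEquiv.symm i))) *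
          (Matrix.reindex finSumFinEquiv finSumFinEquiv (Matrix.fromBlocks A Bm 0 D)).map
            (fun a : ℂ => (MvPolynomial.C a : MvPolynomial σ ℂ))).det =
        (1 + Matrix.diagonal (fun i => MvPolynomial.X (κ₁ i)) * A.map (fun a : ℂ => (MvPolynomial.C a : MvPolynomial σ ℂ))).det *
          (1 + Matrix.diagonal (fun i => MvPolynomial.X (κ₂ i)) * D.map (fun a : ℂ => (MvPolynomial.C a : MvPolynomial σ ℂ))).det ∧
      ‖Matrix.toEuclideanCLM (𝕜 := ℂ) (Matrix.reindex finSumFinEquiv finSumFinEquiv (Matrix.fromBlocks A 0 0 D))‖ ≤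
        max ‖Matrix.toEuclideanCLM (𝕜 := ℂ) A‖ ‖Matrix.toEuclideanCLM (𝕜 := ℂ) D‖ := by
  intro σ R₁ R₂ A Bm D κ₁ κ₂
  refine ⟨?_, ?_⟩
  · rw [det_pencil_reindex finSumFinEquiv (Matrix.fromBlocks A Bm 0 D) (Sum.elim κ₁ κ₂)]
    exact det_pencil_fromBlocks_zero₂₁ A Bm D κ₁ κ₂
  · exact (norm_toEuclideanCLM_reindex_le finSumFinEquiv _).trans
      (norm_toEuclideanCLM_fromBlocks_le A D)

end Summit.ValiantsHypothesis.ValiantsHypothesis.Theorems.PriceOfContractivity.BlockTriangular
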